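import Literature.AlgebraicGeometry.Motives.HodgeGroupOfCMFamilyRealPoints
import Mathlib.Algebra.Ring.Subring.Units
import HarnessLib

/-!
# `MT(⊕ᵢ V¹_{(Kᵢ,Φᵢ)})(ℝ) ≅ ℝ^×_{>0} × Hg(⊕ᵢ V¹_{(Kᵢ,Φᵢ)})(ℝ) ≅ ℝ^×_{>0} × U(1)^{rank Σ - 1}`: the real Mumford–Tate
# group of a CM algebra is the DIRECT PRODUCT of the positive homotheties and the compact real Hodge torus
# (GGK §I.B «`M_φ̃ = 𝔾_m · M_φ` almost direct»; Moonen (5.8); Milne Ex. 12-7; Gordon 9.1 «`rank(K,S) := dim MT(A)`»)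

Family `hodge`, lane `lit-hodgefound` (Track 2 foundations library; Layer A3 «the Mumford–Tate group of a CM abelian
variety is a torus»), layer `Literature/AlgebraicGeometry/Motives`, sub-namespace `Literature.AlgebraicGeometry.Motives.HodgeStructure`
(as `Motives/HodgeGroupOfCMFamilyRealPoints`, whose DEVIATIONS listed «`MT(ℝ)` packaged as factorisation theorems rather than a
MulEquiv» — this file supplies the MulEquiv).  THEOREMS ONLY (no definition, no named fact; D-0026 net debt `0`).

THE PRINTS.  M. Green, P. Griffiths, M. Kerr (2012) [GreenGriffithsKerr2012] §I.B (semi-direct product remark before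
(I.B.1)) «`M_φ̃` is the almost direct product `𝔾_m · M_φ`» and (I.B.1).  B. Moonen (2004) [Moonen2004MT] (5.8) «`Hg =
Ker(MT → 𝔾_m)`».  J. S. Milne, *Algebraic Groups* [Milne2017] Ch. 12 Example 12.27, Exercise 12-7 (a) «a torus over `ℝ` is
a direct product of copies of `𝔾_m`, `U₁`, `(𝔾_m)_{ℂ/ℝ}`», (b) «`T(ℝ)` is compact iff `T` is anisotropic».  B. B. Gordon
[Gordon1999HodgeAVSurvey] §9.1 «`rank(K,S) := dim MT(A)`», Remark 2.12.  P. Deligne [Deligne1982HodgeCycles] I Example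
3.7 (d) (p0026) (the multiplier `e₀`).

THE OBJECTS.  A finite family of CM fields `Kᵢ` with CM types `Φᵢ` (`I ≠ ∅`); `⊕ᵢ V¹_{(Kᵢ,Φᵢ)} = ofCMFamily Φ`; the real
points `MT(⊕)(ℝ) = (ofCMFamily Φ).mumfordTateGroupBaseChange ℝ`, `Hg(⊕)(ℝ) = (ofCMFamily Φ).hodgeGroupBaseChange ℝ` as
subgroups of `GL(ℝ ⊗ ∏ᵢ Kᵢ)`; the positive real homotheties `w(ℝ^×_{>0}) = {t · id | t > 0}`, as the group Mathlib calls
`Units.posSubgroup ℝ`; `rank Σ = CMAlgebra.cmFamilyRank Φ`; Mathlib's `Circle = U(1)`.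

WHAT IS PROVED.  **`nonempty_mumfordTateGroupBaseChange_real_ofCMFamily_mulEquiv_posSubgroup_prod_hodgeGroupBaseChange`** —
**`MT(⊕)(ℝ) ≅ ℝ^×_{>0} × Hg(⊕)(ℝ)`**, the isomorphism being `(t, γ₀) ↦ t · γ₀` (a homomorphism because homotheties are
central; bijective by the existence and uniqueness of the polar factorisation of `Motives/HodgeGroupOfCMFamilyRealPoints` §4,
`exists_pos_smulOfUnit_mul_mem_hodgeGroupBaseChange_real` / `eq_of_smulOfUnit_mul_mem_hodgeGroupBaseChange_real`) —, and
**`nonempty_mumfordTateGroupBaseChange_real_ofCMFamily_mulEquiv_posSubgroup_prod_pi_circle`** — **`MT(⊕)(ℝ) ≅ ℝ^×_{>0} ×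
U(1)^{cmFamilyRank Φ - 1}`** (with the compact torus of §5 there).

DEVIATIONS / SCOPE.  On points, Tannaka-free; as abstract groups (no topology on `MT(ℝ)`); `MT(ℝ)` also equals
`ℝ^× · Hg(ℝ)` with `ℝ^× ∩ Hg(ℝ) = {±1}` (the tree's `smulOfUnit_mem_hodgeGroupBaseChange_real_ofCMFamily_iff`), the
direct-product form uses the positive half.  NOT HERE: the transport to `H¹(∏ᵢ Aᵢ)`; `ℓ`-adic points.

## References
* [GreenGriffithsKerr2012] M. Green, P. A. Griffiths, M. Kerr, *Mumford–Tate Groups and Domains* (2012) — §I.B.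
* [Moonen2004MT] B. Moonen, *An introduction to Mumford–Tate groups* (2004) — (5.8).
* [Milne2017] J. S. Milne, *Algebraic Groups*, CUP (2017) — Ch. 12: Example 12.27, Exercise 12-7.
* [Gordon1999HodgeAVSurvey] B. B. Gordon, *A survey of the Hodge conjecture for abelian varieties* (1999) — 2.12, §9.1.
* [Deligne1982HodgeCycles] P. Deligne, *Hodge cycles on abelian varieties*, in LNM 900 (1982) — I Example 3.7 (d) (re-edition p. 26).

## Provenance
Lane `lit-hodgefound` (Hodge path, Track 2), prover seat `lit-hodgefound-p29` (generation 21), self-proposed row g21-#11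
(closing a DEVIATION of the seat's g21-#1 `Motives/HodgeGroupOfCMFamilyRealPoints`).
-/

noncomputable section

open scoped TensorProduct Classical
open Module NumberField

namespace Literature.AlgebraicGeometry.Motives

namespace HodgeStructure

open RealMult (embCoords)
open Literature.NumberTheory.ComplexMultiplication
open Literature.AlgebraicGeometry.Pohlmann1968 (CMAlgebra.familyType CMAlgebra.mem_familyType_iff
  CMAlgebra.smul_sigma_mk CMAlgebra.conj_smul_sigma CMAlgebra.isCMTypeWith_familyType CMAlgebra.cmFamilyRank)

section Scalars

variable {L : Type} [Field L] {M : Type} [AddCommGroup M] [Module L M]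

/-- `smulOfUnit` is multiplicative (Mathlib's `DistribMulAction.toModuleAut`). [folklore] -/
private theorem smulOfUnit_mul₀ (a b : Lˣ) :
    (LinearEquiv.smulOfUnit (a * b) : M ≃ₗ[L] M) = LinearEquiv.smulOfUnit a * LinearEquiv.smulOfUnit b :=
  map_mul (DistribMulAction.toModuleAut L M) a b

/-- Homotheties are central in `GL(M)`. [folklore] -/
private theorem smulOfUnit_mul_comm₀ (a : Lˣ) (γ : M ≃ₗ[L] M) :
    LinearEquiv.smulOfUnit a * γ = γ * LinearEquiv.smulOfUnit a :=
  LinearEquiv.ext fun x => by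
    change (a : L) • γ x = γ ((a : L) • x)
    rw [map_smul]

/-- `s⁻¹ · (s · γ) = γ`. [folklore] -/
private theorem smulOfUnit_inv_mul_smulOfUnit_mul (a : Lˣ) (γ : M ≃ₗ[L] M) :
    LinearEquiv.smulOfUnit a⁻¹ * (LinearEquiv.smulOfUnit a * γ) = γ := by
  rw [← mul_assoc, ← smulOfUnit_mul₀, inv_mul_cancel,
    show (LinearEquiv.smulOfUnit 1 : M ≃ₗ[L] M) = 1 from LinearEquiv.ext fun x => one_smul L x, one_mul]

end Scalars

variable {I : Type} [Fintype I] [DecidableEq I] {K : I → Type} [∀ i, Field (K i)] [∀ i, NumberField (K i)]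
  [∀ i, IsCMField (K i)] (Φ : ∀ i, CMType (K i)) [HodgeTensorFacts.{0, 0}]

/-! ### `MT(⊕ᵢ V¹_{(Kᵢ,Φᵢ)})(ℝ) ≅ ℝ^×_{>0} × Hg(⊕ᵢ V¹_{(Kᵢ,Φᵢ)})(ℝ) ≅ ℝ^×_{>0} × U(1)^{rank Σ - 1}` -/

/-- **`MT(⊕ᵢ V¹_{(Kᵢ,Φᵢ)})(ℝ) ≅ ℝ^×_{>0} × Hg(⊕ᵢ V¹_{(Kᵢ,Φᵢ)})(ℝ)` as groups**: the polar factorisation of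
`Motives/HodgeGroupOfCMFamilyRealPoints` §4 (`γ = t · γ₀`, `t > 0` unique, `γ₀ ∈ Hg(ℝ)`) packaged as a group isomorphism
`(t, γ₀) ↦ t · γ₀` from the direct product of the positive real homotheties `w(ℝ^×_{>0})` (Mathlib's `Units.posSubgroup ℝ`)
and the real points of the Hodge group (GGK: «`M_φ̃` is the almost-direct product `𝔾_m · M_φ`»; on real points of a CM Hodge
structure, with `𝔾_m(ℝ)^{>0}`, an honest direct product since `ℝ^×_{>0} ∩ Hg(ℝ) = {1}`).
[cite: GreenGriffithsKerr2012, §I.B (semi-direct product remark before (I.B.1))] [cite: Moonen2004MT, (5.8)]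
[cite: Deligne1982HodgeCycles, I Example 3.7 (d) (p. 26)] -/
theorem nonempty_mumfordTateGroupBaseChange_real_ofCMFamily_mulEquiv_posSubgroup_prod_hodgeGroupBaseChange
    [Nontrivial (∀ i, K i)] :
    Nonempty ((ofCMFamily Φ).mumfordTateGroupBaseChange ℝ ≃*
      Units.posSubgroup ℝ × (ofCMFamily Φ).hodgeGroupBaseChange ℝ) := by
  -- the multiplication map `(t, γ₀) ↦ t · γ₀`
  let f : Units.posSubgroup ℝ × (ofCMFamily Φ).hodgeGroupBaseChange ℝ →* (ofCMFamily Φ).mumfordTateGroupBaseChange ℝ :=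
    { toFun := fun p => ⟨LinearEquiv.smulOfUnit (p.1 : ℝˣ) * (p.2 : (ℝ ⊗[ℚ] (∀ i, K i)) ≃ₗ[ℝ] (ℝ ⊗[ℚ] (∀ i, K i))),
        mul_mem (smulOfUnit_mem_mumfordTateGroupBaseChange_real_ofCMFamily Φ _)
          (hodgeGroupBaseChange_le_mumfordTateGroupBaseChange ℝ _ p.2.2)⟩
      map_one' := Subtype.ext (by
        change LinearEquiv.smulOfUnit (1 : ℝˣ) * (1 : (ℝ ⊗[ℚ] (∀ i, K i)) ≃ₗ[ℝ] (ℝ ⊗[ℚ] (∀ i, K i))) = 1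
        rw [mul_one]
        exact LinearEquiv.ext fun x => one_smul ℝ x)
      map_mul' := fun p q => Subtype.ext (by
        change LinearEquiv.smulOfUnit ((p.1 : ℝˣ) * (q.1 : ℝˣ)) *
            ((p.2 : (ℝ ⊗[ℚ] (∀ i, K i)) ≃ₗ[ℝ] (ℝ ⊗[ℚ] (∀ i, K i))) *
              (q.2 : (ℝ ⊗[ℚ] (∀ i, K i)) ≃ₗ[ℝ] (ℝ ⊗[ℚ] (∀ i, K i)))) =
          LinearEquiv.smulOfUnit (p.1 : ℝˣ) * (p.2 : (ℝ ⊗[ℚ] (∀ i, K i)) ≃ₗ[ℝ] (ℝ ⊗[ℚ] (∀ i, K i))) *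
            (LinearEquiv.smulOfUnit (q.1 : ℝˣ) * (q.2 : (ℝ ⊗[ℚ] (∀ i, K i)) ≃ₗ[ℝ] (ℝ ⊗[ℚ] (∀ i, K i))))
        rw [smulOfUnit_mul₀, mul_assoc, mul_assoc, ← mul_assoc (LinearEquiv.smulOfUnit (q.1 : ℝˣ)),
          smulOfUnit_mul_comm₀ (q.1 : ℝˣ), mul_assoc]) }
  have hf : ∀ p, ((f p : (ofCMFamily Φ).mumfordTateGroupBaseChange ℝ) : (ℝ ⊗[ℚ] (∀ i, K i)) ≃ₗ[ℝ] (ℝ ⊗[ℚ] (∀ i, K i))) =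
      LinearEquiv.smulOfUnit (p.1 : ℝˣ) * (p.2 : (ℝ ⊗[ℚ] (∀ i, K i)) ≃ₗ[ℝ] (ℝ ⊗[ℚ] (∀ i, K i))) := fun _ => rfl
  refine ⟨(MulEquiv.ofBijective f ⟨?_, ?_⟩).symm⟩
  · -- injective: uniqueness of the polar factorisation
    rintro ⟨⟨t, ht⟩, γ, hγ⟩ ⟨⟨t', ht'⟩, γ', hγ'⟩ h
    have hΓ := congrArg (fun g : (ofCMFamily Φ).mumfordTateGroupBaseChange ℝ =>
      (g : (ℝ ⊗[ℚ] (∀ i, K i)) ≃ₗ[ℝ] (ℝ ⊗[ℚ] (∀ i, K i)))) h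
    simp only [hf] at hΓ
    change LinearEquiv.smulOfUnit t * γ = LinearEquiv.smulOfUnit t' * γ' at hΓ
    have h1 : LinearEquiv.smulOfUnit t⁻¹ * (LinearEquiv.smulOfUnit t * γ) ∈ (ofCMFamily Φ).hodgeGroupBaseChange ℝ := by
      rw [smulOfUnit_inv_mul_smulOfUnit_mul]; exact hγ
    have h2 : LinearEquiv.smulOfUnit t'⁻¹ * (LinearEquiv.smulOfUnit t * γ) ∈ (ofCMFamily Φ).hodgeGroupBaseChange ℝ := by
      rw [hΓ, smulOfUnit_inv_mul_smulOfUnit_mul]; exact hγ'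
    have htt : t = t' :=
      eq_of_smulOfUnit_mul_mem_hodgeGroupBaseChange_real Φ ((Units.mem_posSubgroup t).1 ht)
        ((Units.mem_posSubgroup t').1 ht') h1 h2
    subst htt
    have hγγ : γ = γ' := by
      rw [← smulOfUnit_inv_mul_smulOfUnit_mul t γ, hΓ, smulOfUnit_inv_mul_smulOfUnit_mul]
    subst hγγ
    rfl
  · -- surjective: existence of the polar factorisation
    rintro ⟨Γ, hΓ⟩
    obtain ⟨t, ht, hmem⟩ := exists_pos_smulOfUnit_mul_mem_hodgeGroupBaseChange_real Φ hΓ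
    refine ⟨⟨⟨t, (Units.mem_posSubgroup t).2 ht⟩, ⟨_, hmem⟩⟩, Subtype.ext ?_⟩
    rw [hf]
    change LinearEquiv.smulOfUnit t * (LinearEquiv.smulOfUnit t⁻¹ * Γ) = Γ
    rw [← inv_inv t, inv_inv t, ← mul_assoc, ← smulOfUnit_mul₀, mul_inv_cancel,
      show (LinearEquiv.smulOfUnit 1 : (ℝ ⊗[ℚ] (∀ i, K i)) ≃ₗ[ℝ] _) = 1 from LinearEquiv.ext fun x => one_smul ℝ x, one_mul]

/-- **`MT(⊕ᵢ V¹_{(Kᵢ,Φᵢ)})(ℝ) ≅ ℝ^×_{>0} × U(1)^{rank Σ - 1}`**: the real points of the Mumford–Tate group of the CM algebra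
form, as an abstract group, the product of the positive reals and the compact torus `U(1)^{cmFamilyRank Φ - 1}` (the
previous theorem with the tree's `nonempty_hodgeGroupBaseChange_real_ofCMFamily_mulEquiv_pi_circle`; Milne Ex. 12-7 (a): a
real torus is a product of copies of `𝔾_m`, `U₁`, `(𝔾_m)_{ℂ/ℝ}` — here, on the identity component of real points,
`ℝ^×_{>0} × U₁(ℝ)^{rank Σ - 1}`, `dim MT = rank Σ` (Gordon 9.1)). [cite: Milne2017, Ch. 12, Example 12.27, Exercise 12-7]
[cite: Gordon1999HodgeAVSurvey, §9.1 and §2 Remark 2.12] [cite: GreenGriffithsKerr2012, §I.B (semi-direct product remark before (I.B.1))] -/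
theorem nonempty_mumfordTateGroupBaseChange_real_ofCMFamily_mulEquiv_posSubgroup_prod_pi_circle [Nontrivial (∀ i, K i)] :
    Nonempty ((ofCMFamily Φ).mumfordTateGroupBaseChange ℝ ≃*
      Units.posSubgroup ℝ × (Fin (CMAlgebra.cmFamilyRank Φ - 1) → Circle)) := by
  obtain ⟨φ⟩ := nonempty_mumfordTateGroupBaseChange_real_ofCMFamily_mulEquiv_posSubgroup_prod_hodgeGroupBaseChange Φ
  obtain ⟨ψ⟩ := nonempty_hodgeGroupBaseChange_real_ofCMFamily_mulEquiv_pi_circle Φ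
  exact ⟨φ.trans (MulEquiv.prodCongr (MulEquiv.refl _) ψ)⟩

end HodgeStructure

end Literature.AlgebraicGeometry.Motives

end
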